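import Literature.Probability.RandomPlanarGeometry.HexSAWBridgeLogDecay
import Mathlib.Analysis.SpecialFunctions.Pow.Real
import Mathlib.Analysis.SpecialFunctions.Log.Basic
import Mathlib.Analysis.Complex.ExponentialBounds
import Mathlib.Data.Nat.Log
import HarnessLib

/-!
# From a block inequality to a logarithmic rate: `(m+1)·W(a qᵐ + b)³ ≤ K` for an antitone `W` gives `W(N) ≤ C (ln N)^{-1/3}`

Topic `Literature/Probability/RandomPlanarGeometry` (lattice-free bookkeeping lemma).  Source of the mechanism: A. Glazman,
I. Manolescu, *Self-avoiding walk on `ℤ²` with Yang–Baxter weights: universality of critical fugacity and 2-point function*,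
Ann. Inst. Henri Poincaré Probab. Stat. 56 (2020), §4.1, proof of Proposition 1.1 ("Summing the above over `L = 9^k` we find
`Σ_k (D^Δ_{4·9^k})³ ≤ 8 Σ_k G(0,k) < ∞` … since `D^Δ_T` is decreasing, this implies `D^Δ_T → 0`"; Proposition 1.1:
"`B_T(π/3) < 1/(log T)^{1/3}` for infinitely many values of `T`"), and D. Krachun, C. Panagiotis, Ann. Probab. 54 (2026),
Lemma 2.3 (monotonicity of the strip/triangle partition functions).  The tree's `hexBridgeLogDecay_of_blocks`
(`HexSAWBridgeLogDecay.lean`) is the instance `W = B_·(x_c)`, blocks `8·10^m + 1`; the present file isolates the elementary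
step ONCE, over abstract data, so that every frame (parallel strips, rotated strips, other lattices) instantiates it:

* `antitone_le_log_rpow_of_blocks` — if `W : ℕ → ℝ` is antitone with `0 ≤ W ≤ Wmax` and
  `(m+1) · W(a·q^m + b)³ ≤ K` for every `m` (`a ≥ 1`, `q ≥ 2`, `K ≥ 0`), then for every `N ≥ 2`
  `W(N) ≤ max(Wmax · (ln(((a+b)q)²))^{1/3}, (2K·ln q)^{1/3}) · (ln N)^{-1/3}`.

Proof: with `m = ⌊log_q((N−b)/a)⌋` one has `a q^m + b ≤ N < a q^{m+1} + b`; for `N ≥ ((a+b)q)²` this forces `a + b ≤ q^{m+1}`,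
hence `ln N ≤ 2(m+1) ln q` and `W(N) ≤ W(a q^m + b) ≤ (K/(m+1))^{1/3} ≤ (2K ln q)^{1/3} (ln N)^{-1/3}`; below the threshold
`W ≤ Wmax` suffices.  No lattice input.

* `hexBridgeLogDecay_of_blocks'` — BY-NAME CHECK of the abstraction: the tree's `HexBridgeLogDecayBlocks → HexBridgeLogDecay 5 2`
  (`HexSAWBridgeLogDecay.lean`) re-derived as the instance `W = B_·(x_c)`, `a = 8`, `q = 10`, `b = 1`, `K = 8/cos(3π/8)`,
  `Wmax = 1` (numerics: `(ln 8100)^{1/3} ≤ 5` and `(16·(10/3)·2.33)^{1/3} ≤ 5`);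
* an `example` — the rotated-frame instance (blocks `4·20^m + 3`) over an abstract block hypothesis, i.e. the shape in which a
  perpendicular-frame (Beaton 2014) block inequality would be consumed.

PROVENANCE.  The abstract step was first kernel-checked in HOME by a-idea-1 (Sketch_G15_R95, `RotGM.logRate_of_blocks`, blocks
`4·r^m`, 2026-08-23); this file states the three-parameter form `a·q^m + b` with an explicit constant; the proof below is
independent.
-/

noncomputable section

open Real Literature.Probability.LatticeModels

namespace Literature.Probability.RandomPlanarGeometry.SAW

open HV

/-- Cube-root extraction: `0 ≤ w`, `w³ ≤ X` ⇒ `w ≤ X^{1/3}`. [folklore] -/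
private theorem le_rpow_third_of_pow_three_le {w X : ℝ} (hw : 0 ≤ w) (h : w ^ 3 ≤ X) : w ≤ X ^ ((1 : ℝ) / 3) := by
  have hX : 0 ≤ X := le_trans (by positivity) h
  calc w = (w ^ 3) ^ ((3 : ℕ) : ℝ)⁻¹ := (Real.pow_rpow_inv_natCast hw (by norm_num)).symm
    _ ≤ X ^ ((3 : ℕ) : ℝ)⁻¹ := Real.rpow_le_rpow (by positivity) h (by positivity)
    _ = X ^ ((1 : ℝ) / 3) := by norm_num

/-- `(X / Y)^{1/3} = X^{1/3} · Y^{-1/3}` for `X, Y ≥ 0`. [folklore] -/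
private theorem div_rpow_third {X Y : ℝ} (hX : 0 ≤ X) (hY : 0 ≤ Y) :
    (X / Y) ^ ((1 : ℝ) / 3) = X ^ ((1 : ℝ) / 3) * Y ^ (-(1 : ℝ) / 3) := by
  rw [Real.div_rpow hX hY, div_eq_mul_inv, show (-(1 : ℝ) / 3) = -((1 : ℝ) / 3) by ring, Real.rpow_neg hY]

/-- **Block inequality ⇒ logarithmic rate.**  Let `W : ℕ → ℝ` be antitone with `0 ≤ W n ≤ Wmax`, and suppose the BLOCK
inequality `(m+1) · W(a·q^m + b)³ ≤ K` for every `m` (`a ≥ 1`, `q ≥ 2`, `K ≥ 0`).  Then for every `N ≥ 2`,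
`W(N) ≤ max(Wmax · (ln(((a+b)q)²))^{1/3}, (2K·ln q)^{1/3}) · (ln N)^{-1/3}`.
(Glazman–Manolescu's "`Σ_k (D_{4·9^k})³ < ∞` and `D` decreasing" step, made pointwise and explicit; the tree's
`hexBridgeLogDecay_of_blocks` is the instance `a = 8`, `q = 10`, `b = 1`.)
[cite: GlazmanManolescu2019, Proposition 1.1 and §4.1 (proof); KrachunPanagiotis2026, Lemma 2.3] -/
theorem antitone_le_log_rpow_of_blocks {W : ℕ → ℝ} (hW : Antitone W) (h0 : ∀ n, 0 ≤ W n) {Wmax : ℝ}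
    (h1 : ∀ n, W n ≤ Wmax) {a b q : ℕ} (ha : 1 ≤ a) (hq : 2 ≤ q) {K : ℝ} (hK : 0 ≤ K)
    (hblock : ∀ m : ℕ, ((m : ℝ) + 1) * W (a * q ^ m + b) ^ 3 ≤ K) (N : ℕ) (hN : 2 ≤ N) :
    W N ≤ max (Wmax * (Real.log ((((a + b) * q) ^ 2 : ℕ) : ℝ)) ^ ((1 : ℝ) / 3)) ((2 * K * Real.log q) ^ ((1 : ℝ) / 3))
      * (Real.log N) ^ (-(1 : ℝ) / 3) := by
  have hN' : (2 : ℝ) ≤ N := by exact_mod_cast hN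
  have hlN : 0 < Real.log N := Real.log_pos (by linarith)
  have hr0 : 0 < (Real.log N) ^ (-(1 : ℝ) / 3) := Real.rpow_pos_of_pos hlN _
  have hWmax : 0 ≤ Wmax := (h0 0).trans (h1 0)
  have hq1 : 1 < q := by omega
  have hq' : (2 : ℝ) ≤ q := by exact_mod_cast hq
  have hlq : 0 < Real.log q := Real.log_pos (by linarith)
  set N₁ : ℕ := ((a + b) * q) ^ 2 with hN₁
  by_cases hsmall : N < N₁
  · -- below the threshold: `W ≤ Wmax ≤ Wmax (ln N₁)^{1/3} (ln N)^{-1/3}`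
    have hNN₁ : (N : ℝ) ≤ N₁ := by exact_mod_cast hsmall.le
    have hlog : Real.log N ≤ Real.log N₁ := Real.log_le_log (by linarith) hNN₁
    have hone : 1 ≤ (Real.log N₁) ^ ((1 : ℝ) / 3) * (Real.log N) ^ (-(1 : ℝ) / 3) := by
      have h3 : (Real.log N) ^ ((1 : ℝ) / 3) ≤ (Real.log N₁) ^ ((1 : ℝ) / 3) :=
        Real.rpow_le_rpow hlN.le hlog (by norm_num)
      have hinv : (Real.log N) ^ (-(1 : ℝ) / 3) = ((Real.log N) ^ ((1 : ℝ) / 3))⁻¹ := by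
        rw [show (-(1 : ℝ) / 3) = -((1 : ℝ) / 3) by ring, Real.rpow_neg hlN.le]
      have hpos : 0 < (Real.log N) ^ ((1 : ℝ) / 3) := Real.rpow_pos_of_pos hlN _
      rw [hinv, ← div_eq_mul_inv, le_div_iff₀ hpos, one_mul]
      exact h3
    calc W N ≤ Wmax := h1 N
      _ ≤ Wmax * ((Real.log N₁) ^ ((1 : ℝ) / 3) * (Real.log N) ^ (-(1 : ℝ) / 3)) :=
          le_mul_of_one_le_right hWmax hone
      _ = Wmax * (Real.log N₁) ^ ((1 : ℝ) / 3) * (Real.log N) ^ (-(1 : ℝ) / 3) := by ring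
      _ ≤ _ := mul_le_mul_of_nonneg_right (le_max_left _ _) hr0.le
  · -- above the threshold: the block `m = ⌊log_q ((N-b)/a)⌋`
    rw [not_lt] at hsmall
    have hab1 : 1 ≤ a + b := by omega
    have hN₁ge : a + b ≤ N₁ := by
      calc a + b ≤ (a + b) * q := Nat.le_mul_of_pos_right _ (by omega)
        _ ≤ ((a + b) * q) ^ 2 := by nlinarith
    have hbN : b ≤ N := by omega
    have haN : a ≤ N - b := by omega
    set n := (N - b) / a with hn
    have hn1 : 1 ≤ n := (Nat.le_div_iff_mul_le (by omega)).2 (by simpa using haN)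
    set m := Nat.log q n with hm
    -- `a q^m + b ≤ N`
    have hlow : a * q ^ m + b ≤ N := by
      have h := Nat.pow_log_le_self q (by omega : n ≠ 0)
      have h' : q ^ m * a ≤ N - b := (Nat.le_div_iff_mul_le (by omega)).1 h
      have : a * q ^ m ≤ N - b := by rwa [mul_comm] at h'
      omega
    -- `N < a q^{m+1} + b ≤ (a+b) q^{m+1}`
    have hup : N < (a + b) * q ^ (m + 1) := by
      have h := Nat.lt_pow_succ_log_self hq1 n
      have h' : N - b < q ^ (m + 1) * a := (Nat.div_lt_iff_lt_mul (by omega)).1 h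
      have hb : b ≤ b * q ^ (m + 1) := Nat.le_mul_of_pos_right _ (by positivity)
      have : N < a * q ^ (m + 1) + b := by rw [mul_comm] at h'; omega
      calc N < a * q ^ (m + 1) + b := this
        _ ≤ a * q ^ (m + 1) + b * q ^ (m + 1) := by omega
        _ = (a + b) * q ^ (m + 1) := by ring
    -- hence `a + b ≤ q^{m+1}`
    have habq : a + b ≤ q ^ (m + 1) := by
      have h2 : ((a + b) * q) ^ 2 < (a + b) * q ^ (m + 1) := lt_of_le_of_lt hsmall hup
      have h3 : (a + b) * ((a + b) * q ^ 2) < (a + b) * q ^ (m + 1) := by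
        calc (a + b) * ((a + b) * q ^ 2) = ((a + b) * q) ^ 2 := by ring
          _ < (a + b) * q ^ (m + 1) := h2
      have h4 : (a + b) * q ^ 2 < q ^ (m + 1) := Nat.lt_of_mul_lt_mul_left h3
      calc a + b ≤ (a + b) * q ^ 2 := Nat.le_mul_of_pos_right _ (by positivity)
        _ ≤ q ^ (m + 1) := h4.le
    -- `ln N ≤ 2 (m+1) ln q`
    have hlogN : Real.log N ≤ 2 * ((m : ℝ) + 1) * Real.log q := by
      have hNr : (N : ℝ) ≤ (a + b : ℝ) * (q : ℝ) ^ (m + 1) := by exact_mod_cast hup.le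
      have habr : ((a + b : ℕ) : ℝ) ≤ (q : ℝ) ^ (m + 1) := by exact_mod_cast habq
      have hab0 : (0 : ℝ) < (a + b : ℕ) := by exact_mod_cast (by omega : 0 < a + b)
      calc Real.log N ≤ Real.log ((a + b : ℝ) * (q : ℝ) ^ (m + 1)) := Real.log_le_log (by linarith) hNr
        _ = Real.log ((a + b : ℕ) : ℝ) + ((m : ℝ) + 1) * Real.log q := by
            push_cast
            rw [Real.log_mul (by positivity) (by positivity), Real.log_pow]; push_cast; ring
        _ ≤ ((m : ℝ) + 1) * Real.log q + ((m : ℝ) + 1) * Real.log q := by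
            refine add_le_add ?_ le_rfl
            calc Real.log ((a + b : ℕ) : ℝ) ≤ Real.log ((q : ℝ) ^ (m + 1)) := Real.log_le_log hab0 habr
              _ = ((m : ℝ) + 1) * Real.log q := by rw [Real.log_pow]; push_cast; ring
        _ = 2 * ((m : ℝ) + 1) * Real.log q := by ring
    -- the block inequality at `m`
    have hm0 : (0 : ℝ) < (m : ℝ) + 1 := by positivity
    have hW3 : W (a * q ^ m + b) ^ 3 ≤ 2 * K * Real.log q / Real.log N := by
      have hb := hblock m
      rw [le_div_iff₀ hlN]
      calc W (a * q ^ m + b) ^ 3 * Real.log N ≤ W (a * q ^ m + b) ^ 3 * (2 * ((m : ℝ) + 1) * Real.log q) :=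
            mul_le_mul_of_nonneg_left hlogN (pow_nonneg (h0 _) 3)
        _ = 2 * Real.log q * (((m : ℝ) + 1) * W (a * q ^ m + b) ^ 3) := by ring
        _ ≤ 2 * Real.log q * K := mul_le_mul_of_nonneg_left hb (by positivity)
        _ = 2 * K * Real.log q := by ring
    calc W N ≤ W (a * q ^ m + b) := hW hlow
      _ ≤ (2 * K * Real.log q / Real.log N) ^ ((1 : ℝ) / 3) := le_rpow_third_of_pow_three_le (h0 _) hW3
      _ = (2 * K * Real.log q) ^ ((1 : ℝ) / 3) * (Real.log N) ^ (-(1 : ℝ) / 3) :=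
          div_rpow_third (by positivity) hlN.le
      _ ≤ _ := mul_le_mul_of_nonneg_right (le_max_right _ _) hr0.le


/-! ### Instance 1 (by-name check): the tree's parallel-frame decay `B_T(x_c) ≤ 5 (ln T)^{-1/3}` re-derived -/

/-- `cos(3π/8) ≥ 3/10` (`cos(3π/8) = sin(π/8) = √(2−√2)/2 = 0.3827`). [folklore] -/
private theorem three_div_ten_le_cos_three_pi_div_eight' : (3 : ℝ) / 10 ≤ Real.cos (3 * Real.pi / 8) := by
  rw [show (3 * Real.pi / 8 : ℝ) = Real.pi / 2 - Real.pi / 8 by ring, Real.cos_pi_div_two_sub,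
    Real.sin_pi_div_eight]
  have h2 : Real.sqrt 2 ≤ 3 / 2 := by
    rw [show (3 / 2 : ℝ) = Real.sqrt ((3 / 2) ^ 2) by rw [Real.sqrt_sq (by norm_num)]]
    exact Real.sqrt_le_sqrt (by norm_num)
  have h3 : (3 : ℝ) / 5 ≤ Real.sqrt (2 - Real.sqrt 2) := by
    rw [Real.le_sqrt' (by norm_num)]; linarith
  linarith

/-- `ln 10 ≤ 2.33` (`ln 10 = 3 ln 2 + ln(5/4) ≤ 3·0.6931471808 + 1/4`). [folklore] -/
private theorem log_ten_le' : Real.log 10 ≤ 233 / 100 := by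
  have h : Real.log 10 = 3 * Real.log 2 + Real.log (5 / 4) := by
    rw [show (10 : ℝ) = 2 ^ 3 * (5 / 4) by norm_num, Real.log_mul (by norm_num) (by norm_num),
      Real.log_pow]; push_cast; ring
  have h54 : Real.log (5 / 4) ≤ 5 / 4 - 1 := Real.log_le_sub_one_of_pos (by norm_num)
  rw [h]; linarith [Real.log_two_lt_d9]

/-- `X ≤ 125` ⇒ `X^{1/3} ≤ 5` (`X ≥ 0`). [folklore] -/
private theorem rpow_third_le_five {X : ℝ} (hX : 0 ≤ X) (h : X ≤ 125) : X ^ ((1 : ℝ) / 3) ≤ 5 := by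
  calc X ^ ((1 : ℝ) / 3) ≤ (125 : ℝ) ^ ((1 : ℝ) / 3) := Real.rpow_le_rpow hX h (by norm_num)
    _ = ((5 : ℝ) ^ 3) ^ ((3 : ℕ) : ℝ)⁻¹ := by norm_num
    _ = 5 := Real.pow_rpow_inv_natCast (by norm_num) (by norm_num)

/-- **By-name check of the abstraction**: the tree's `HexBridgeLogDecayBlocks → HexBridgeLogDecay 5 2`
(`HexSAWBridgeLogDecay.lean`, there proved by hand) is the instance `W(n) = B_{max(n,1)}(x_c)`, `a = 8`, `q = 10`, `b = 1`,
`K = 8/cos(3π/8)`, `Wmax = 1` of `antitone_le_log_rpow_of_blocks`.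
[cite: GlazmanManolescu2019, Proposition 1.1 and eq. (3); KrachunPanagiotis2026, Lemma 2.3] -/
theorem hexBridgeLogDecay_of_blocks' (h : HexBridgeLogDecayBlocks) : HexBridgeLogDecay 5 2 := by
  intro T hT
  have hT1 : 1 ≤ T := by omega
  set c := Real.cos (3 * Real.pi / 8) with hc
  have hc0 : 0 < c := lt_of_lt_of_le (by norm_num) three_div_ten_le_cos_three_pi_div_eight'
  set W : ℕ → ℝ := fun n => HV.stripBlim (max n 1) with hWdef
  have hW : Antitone W := fun n n' hnn' =>
    stripBlim_antitone' (le_max_right _ _) (max_le_max hnn' le_rfl)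
  have h0 : ∀ n, 0 ≤ W n := fun n => stripBlim_nonneg (le_max_right _ _)
  have h1 : ∀ n, W n ≤ 1 := fun n => stripBlim_le_one (le_max_right _ _)
  -- the block inequality, cubed, with `cos(π/8) ≤ 1`
  have hblock : ∀ m : ℕ, ((m : ℝ) + 1) * W (8 * 10 ^ m + 1) ^ 3 ≤ 8 * c⁻¹ := by
    intro m
    have hm : (0 : ℝ) < (m : ℝ) + 1 := by positivity
    have hWm : W (8 * 10 ^ m + 1) = HV.stripBlim (8 * 10 ^ m + 1) := by
      simp only [hWdef]; rw [max_eq_left (by omega)]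
    have hb := h m (8 * 10 ^ m + 1) le_rfl
    have hcos : Real.cos (Real.pi / 8) ≤ 1 := Real.cos_le_one _
    have hcos0 : 0 ≤ Real.cos (Real.pi / 8) := cos_pi_div_eight_pos.le
    have hy0 : 0 ≤ c⁻¹ / ((m : ℝ) + 1) := by positivity
    -- `B ≤ 2 (c⁻¹/(m+1))^{1/3}`
    have hb' : HV.stripBlim (8 * 10 ^ m + 1) ≤ 2 * (c⁻¹ / ((m : ℝ) + 1)) ^ ((1 : ℝ) / 3) := by
      refine hb.trans (mul_le_mul_of_nonneg_right ?_ (Real.rpow_nonneg hy0 _))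
      linarith
    have hB0 : 0 ≤ HV.stripBlim (8 * 10 ^ m + 1) := stripBlim_nonneg (by omega)
    -- cube: `B^3 ≤ 8 c⁻¹/(m+1)`
    have hcube : HV.stripBlim (8 * 10 ^ m + 1) ^ 3 ≤ 8 * (c⁻¹ / ((m : ℝ) + 1)) := by
      have h3 := pow_le_pow_left₀ hB0 hb' 3
      have hr : ((c⁻¹ / ((m : ℝ) + 1)) ^ ((1 : ℝ) / 3)) ^ 3 = c⁻¹ / ((m : ℝ) + 1) := by
        rw [← Real.rpow_natCast, ← Real.rpow_mul hy0]; norm_num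
      calc HV.stripBlim (8 * 10 ^ m + 1) ^ 3 ≤ (2 * (c⁻¹ / ((m : ℝ) + 1)) ^ ((1 : ℝ) / 3)) ^ 3 := h3
        _ = 8 * (c⁻¹ / ((m : ℝ) + 1)) := by rw [mul_pow, hr]; norm_num
    rw [hWm]
    calc ((m : ℝ) + 1) * HV.stripBlim (8 * 10 ^ m + 1) ^ 3 ≤ ((m : ℝ) + 1) * (8 * (c⁻¹ / ((m : ℝ) + 1))) :=
          mul_le_mul_of_nonneg_left hcube hm.le
      _ = 8 * c⁻¹ := by field_simp
  have hmain := antitone_le_log_rpow_of_blocks hW h0 h1 (a := 8) (b := 1) (q := 10) (by norm_num) (by norm_num)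
    (K := 8 * c⁻¹) (by positivity) hblock T hT
  have hWT : W T = HV.stripBlim T := by simp only [hWdef]; rw [max_eq_left hT1]
  rw [hWT] at hmain
  have hT' : (2 : ℝ) ≤ T := by exact_mod_cast hT
  have hlT : 0 < Real.log T := Real.log_pos (by linarith)
  refine hmain.trans (mul_le_mul_of_nonneg_right ?_ (Real.rpow_nonneg hlT.le _))
  -- both branches of the constant are `≤ 5`
  refine max_le ?_ ?_
  · rw [one_mul]
    refine rpow_third_le_five (Real.log_nonneg (by norm_num)) ?_
    have h4 : Real.log ((((8 + 1) * 10) ^ 2 : ℕ) : ℝ) ≤ Real.log ((10 : ℝ) ^ 4) :=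
      Real.log_le_log (by norm_num) (by norm_num)
    rw [Real.log_pow] at h4
    push_cast at h4 ⊢
    linarith [log_ten_le']
  · refine rpow_third_le_five (by positivity) ?_
    have hcinv : c⁻¹ ≤ 10 / 3 := by
      rw [inv_le_comm₀ hc0 (by norm_num)]
      exact le_trans (by norm_num) three_div_ten_le_cos_three_pi_div_eight'
    have hl10 := log_ten_le'
    have hl0 : 0 ≤ Real.log 10 := Real.log_nonneg (by norm_num)
    push_cast
    nlinarith [mul_le_mul hcinv hl10 hl0 (by norm_num : (0:ℝ) ≤ 10 / 3)]

/-! ### Instance 2 (shape for the perpendicular frame): blocks `4·20^m + 3` -/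

/-- The rotated-frame shape: an antitone `W` with `0 ≤ W ≤ Wmax` and `(m+1)·W(4·20^m + 3)³ ≤ K` satisfies
`W(N) ≤ max(Wmax (ln 19600)^{1/3}, (2K ln 20)^{1/3}) (ln N)^{-1/3}` for `N ≥ 2` — the form in which a block inequality for
Beaton's rotated strips would be consumed. [cite: GlazmanManolescu2019, §4.1 (proof of Proposition 1.1)] -/
example {W : ℕ → ℝ} (hW : Antitone W) (h0 : ∀ n, 0 ≤ W n) {Wmax K : ℝ} (h1 : ∀ n, W n ≤ Wmax) (hK : 0 ≤ K)
    (hblock : ∀ m : ℕ, ((m : ℝ) + 1) * W (4 * 20 ^ m + 3) ^ 3 ≤ K) (N : ℕ) (hN : 2 ≤ N) :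
    W N ≤ max (Wmax * (Real.log ((((4 + 3) * 20) ^ 2 : ℕ) : ℝ)) ^ ((1 : ℝ) / 3)) ((2 * K * Real.log (20 : ℕ)) ^ ((1 : ℝ) / 3))
      * (Real.log N) ^ (-(1 : ℝ) / 3) :=
  antitone_le_log_rpow_of_blocks hW h0 h1 (by norm_num) (by norm_num) hK hblock N hN

end Literature.Probability.RandomPlanarGeometry.SAW

end
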